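import Literature.MathematicalPhysics.QuantumFieldTheory.Balaban1983to89.B14Eq213DetSet
import Literature.MathematicalPhysics.QuantumFieldTheory.Balaban1983to89.B14Eq12LocalityQsstar
import Literature.MathematicalPhysics.QuantumFieldTheory.Balaban1983to89.B14Sect3Decomp

/-!
# `Balaban1983to89.B14Eq216Concrete` — CMP 119 (2.16)–(2.17) p. 257 and (1.2) p. 246 WITH BODIES on the carriers of record:
# the localized background field `U_{k,□}(V_k) = U(𝐁_k(□^{∼4}), M˙(Q_k^{s*}V_k))` assembled from r12's (2.12) solution datum
# `DetBackground.U`, r11's (2.13) determining set `Bj`, r12's (2.11) `avgFamily` and p31's (1.3) `qsstarGIter0`; the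
# small-field function `χ_k(Ω_k)` of (2.17); the `Sect1Data` / `Sect3Data` instances that make (1.2), (1.4), (3.2)–(3.4)
# concrete; and the p. 246 dependence sentence in its exact conditional form (averaging locality and (1.3)-locality
# PROVED and iterated; the locality of the [15] minimizer is the hypothesis)

statement-level skeleton of published theorems with citation tags; proofs where landed; nothing here is a claim about the Yang–Mills mass gap

CITATION HEADER (lean-in-tree rule).  Source: T. Bałaban, *Convergent renormalization expansions for lattice gauge
theories*, Commun. Math. Phys. **119**, 243–285 (1988), doi:10.1007/bf01217741 [Balaban1988Convergent] (cell paper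
B14 = «[III]»; held `paper:balaban1988-cmp119-convergent-renormalization`, journal page = PDF page + 242; pp. 246, 255–257
and 265 read on the text layer `p0013`–`p0015`, `p0023` and the x2 renders `…-p004-x2.png`, `…-p015-x2.png`).
Mega-formalization `lit-balaban`, unit `lit-balaban-r11` (CMP 119, B14 fold owner), SKELETON rows **B14.Eq2.16**,
**B14.Eq2.17**, **B14.Eq1.2**, **B14.Eq1.4**, **B14.Eq3.2–3.4** — the owner's READING-RULE audit
`READING-RULE-AUDIT-B14-g96.md` §4 batch 2 item (vi): *"the `Sect1Data` instance for (1.2): `Umap := DetBackground.U`,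
`B1enl4 := Bj`, `Mdot := avgFamily`, `Qsstar := qsstarG`"*, which is the `k = 1` case of (2.16).
v1.1 (same seat): + §1b, the printed k-block case formula for `qsstarGIter0` (theorems only; every v1 declaration
byte-identical).

THE PRINTED TEXT, verbatim.
* p. 257 [PDF 15]: *"We consider the partition of the lattice T_η into LM₂R_k-cubes, compatible with the other partitions,
  and for each cube □ of this partition we define the function U_{k,□}(V_k) by
    U_{k,□}(V_k) = U(𝐁_k(□^{∼4}), M˙(Q_k^{s*}V_k)),   (2.16)
  where Q_k^{s*}V_k is defined as in (1.3), only 1-blocks are replaced by k-blocks. The notation in (2.16) is a slightly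
  different, simplified version of the notation in (2.13). Let us write now a general form of the expansion of the density
  ρ_k. At first we define
    χ_k(Ω_k) = Π_{□⊂Ω_k} χ({sup_{p⊂□^∼}|U_{k,□}(V_k, ∂p) − 1| < ε_kη²}),   (2.17)
  where the cubes □ belong to the partition of the lattice T_η into cubes of the size LM₂R_k."*
* p. 246 [PDF 4]: *"For every L²M₂R₁-cube □′ contained in (P₀′^∼)ᶜ we construct the function U_{1,□′}(V) as
    U_{1,□′}(V) = U(𝐁₁(□′^{∼4}), M˙(Q₁^{s*}V)),   (1.2)
  where 𝐁₁(□′^{∼4}) is the minimal determining set based on □′^{∼4}, and Q₁^{s*}V was introduced in (4.5.3) [18]. … The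
  function in (1.2) depends on the field V restricted to □′^{∼4}."*  ((1.4) p. 246 and (3.2)–(3.4) p. 265 are quoted in
  `…B14Sect1Repr` and `…B14Sect3Decomp`, whose data structures `Sect1Data` / `Sect3Data` this file instantiates.)

THE CARRIERS OF RECORD, all pre-existing, knitted BY NAME (nothing re-declared).  `Site P 0 = T_η` the finest lattice of
the step, `Site P j = T^{(j)}`, `GaugeField P j G` (`Setup`); the determining-set calculus of (2.2)/(2.10)–(2.12):
`DetSet`, `MSField`, `bondsOf`, `AgreeOn` (2.10), `avgFamily av U = (j ↦ M^j(U))` (2.11) = `M˙(·)`, `IsMinimizer` and the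
solution map of (2.12) as the DATUM `DetBackground` with its defining property (r12, `…B15DeterminingSets`, row B14.Eq2.12
= [15] Thm 1, existence/uniqueness NOT asserted anywhere in the tree); `Bj M₁ Ω j = 𝐁_j(Ω)` of (2.13) and `minConf` =
`U_{j,Ω}(·)` (r11, `…B14Eq213DetSet`); `qsstarG` = `Q^{s*}` of (1.3) = (4.5.3) [18] and its k-block composite
`qsstarGIter0 k` (p31, `…BIJ85Eq453GaugeField`); `chiSmall S δ U = χ({sup_{p∈S}|U(∂p) − 1| < δ})` and `η = P.eta k =
L^{−k}` (`Setup`).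

WHAT IS TYPED / PROVED.
§1  Locality of the iterated averaging `M^j` and of `Q_k^{s*}`, PROVED: `feeds j c` = the fine bonds the axiom
    `Averaging.local_dep` lets `M^j(U)(c)` depend on, `iter_local` (induction on `j`, standing range `j ≤ m + K`);
    `inputs 𝔅` and `agreeOn_avgFamily` (the (2.11) data `M_𝔅(U)` agree as soon as `U = U′` on the inputs); `lift1`,
    `liftIter k S` and `qsstarGIter0_local` ((1.3) iterated: `Q_k^{s*}V` on `S` is determined by `V` on `liftIter k S`,
    from r11 gen 4's one-step `qsstarG_local`).
§1b (v1.1) **(2.16)'s clause «Q_k^{s*}V_k is defined as in (1.3), only 1-blocks are replaced by k-blocks» PROVED for the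
    composite of record**: `qsstarGIter0_eq` — `(Q_k^{s*}V)(b) = 1` inside a k-block, `= V⟨B^k(b₋), μ(b)⟩` on a corridor (base-0
    twin of p31's `qsstarGIter_eq`, over r11's k-fold block map `B14.Eq22Determines.blockIter`; `blockIter_shift`).
§2  **(2.16) WITH BODY**: `ukBox bg M₁ □4 k V_k := bg.U (Bj M₁ □4 k) (avgFamily av (qsstarGIter0 k V_k))`; print's remark
    *"a simplified version of the notation in (2.13)"* is `ukBox_eq_minConf : U_{k,□}(V_k) = U_{k,□^{∼4}}(M˙(Q_k^{s*}V_k))`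
    (`rfl`); `ukBox_eq_bgKZ` (= r12's (1.74) [Balaban1989LargeFieldI] shape `bgKZ` with `𝔹_k(Z) := 𝐁_k(□^{∼4})`, `rfl`);
    `isMinimizer_ukBox` ((2.12) for it); `ukBox_one` (the `k = 1` case is (1.2) with `Q₁^{s*} = qsstarG`).  Dependence:
    `ukBox_congr_on` / `ukBox_congr` — IF the datum `U(𝐁_k(□^{∼4}), ·)` depends on its data only through the data on (a
    sub-family `𝔅′` of) `𝐁_k(□^{∼4})` (on a set `S` of fine bonds), THEN `U_{k,□}(V_k)` (on `S`) depends on `V_k` only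
    through `V_k↾liftIter k (inputs 𝔅′)`; the two other localities are the proved §1.
§3  **(2.17) WITH BODY**: `chi217 bg M₁ X plaqT enl4 ε_k k V_k := Π_{□∈X} chiSmall (plaqT □) (ε_k·η²) (U_{k,□}(V_k))`, the
    cube family `X` (the LM₂R_k-cubes of `Ω_k`), the plaquette sets `p ⊂ □^∼` and the enlargements `□^{∼4}` entering as
    parameters (print's cube geometry, rows B14.Def§1.scales / B14.Eq2.1); `chi217_eq_one_iff` (the `0/1` reading used on
    p. 266 *"Thus χ_k(□) = 1 …"*).
§4  **(1.2)**: `sect1Of bg M₁ D enl4 : Sect1Data P G` replaces the four abstract analytic fields of a `Sect1Data` by the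
    carriers of record (`Umap := bg.U`, `B1enl4 := 𝐁₁(□′^{∼4})`, `Mdot := avgFamily av`, `Qsstar := qsstarGIter0 1 = qsstarG`);
    `u1loc_sect1Of : U_{1,□′}(V) = ukBox bg M₁ (□′^{∼4}) 1 V` (`rfl`); (1.4) for it is `eq14_sect1Of` and `chi1_sect1Of :
    χ₁ = chi217 … 1` (threshold `ε₁L⁻² = ε₁η²` at `k = 1`); the p. 246 sentence in the exact conditional form
    `u1locDependsOn_sect1Of` (gen 2's predicate `U1locDependsOn` with the explicit bond family `liftIter 1 (inputs 𝐁₁(□′^{∼4}))`).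
§5  **(3.2)–(3.4)**: `sect3Of bg M₁ D enl4 : Sect3Data P G k` puts `UkLoc := U_{k+1,□′}(·) = ukBox … (k+1)`; `chiNext_sect3Of :
    χ_{k+1} = chi217 … (k+1)` (`rfl`: (3.2)'s function IS (2.17) at the next scale), `vbox_sect3Of` ((3.4) `V^{(k)}_{□′} =
    M^k(U_{k+1,□′})` on the carriers), `eq32_sect3Of`, `eq33_sect3Of` ((3.2), (3.3) PROVED for the instance, by name).

READING NOTE on the p. 246 sentence (located, not an erratum).  By (2.2) p. 255 the scale-0 member of a determining set is
`Γ₀ = Ω₁ᶜ` (`B14.Eq213DetSet.Bj_zero`), so as a configuration on the WHOLE torus `U(𝐁₁(□′^{∼4}), M˙(Q₁^{s*}V))` carries the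
data `Q₁^{s*}V` on all of `Ω₁(□′^{∼4})ᶜ`, and the whole-lattice input family `liftIter 1 (inputs (𝐁₁(□′^{∼4})))` of
`u1locDependsOn_sect1Of` is correspondingly large; print's *"depends on the field V restricted to □′^{∼4}"* concerns the
function where (1.4) reads it — on the plaquettes `p ⊂ □′^∼`, inside the support of `𝐁₁(□′^{∼4})` (p. 255: *"The domain
Ω₁, or rather a small neighborhood of Ω₁ …, is called its support"*) — and uses the interior locality of the [15]
minimizer; that is the instance `S :=` the bonds of the support, `𝔅′ := 𝐁₁(□′^{∼4})` restricted to `□′^{∼4}` of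
`ukBox_congr_on`, whose hypothesis `hloc` is exactly this [15] property (row B14.Eq2.12 = B11.Thm1; NOT asserted).

NOT ASSERTED: existence, uniqueness or locality of the minimal configurations `U(𝐁, ·)` ([15] = [Balaban1985Variational]
Thm 1), the cube geometry of pp. 245/257 (parameters), anything about (2.18).  No new `Prop` definitions without body, no
`sorry`.

## References
* [Balaban1988Convergent] T. Bałaban, Commun. Math. Phys. 119 (1988) 243–285, (1.2)–(1.4) p. 246, (2.2) p. 255,
  (2.11)–(2.13) pp. 256–257, (2.16)–(2.17) p. 257, (3.2)–(3.4) p. 265.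
* [Balaban1985Variational] T. Bałaban, Commun. Math. Phys. 102 (1985) 277–309, Thm 1 ([15]: the map `U(𝐁, ·)`).
* [BalabanImbrieJaffe1985] T. Bałaban, J. Imbrie, A. Jaffe, Commun. Math. Phys. 97 (1985) 299–329, (4.5.3) p. 312 ([18]).
* [Balaban1989LargeFieldI] T. Bałaban, Commun. Math. Phys. 122 (1989) 175–202, (1.74) p. 192 (`bgKZ`).
-/

noncomputable section

namespace Literature.MathematicalPhysics.QuantumFieldTheory.Balaban1983to89.B14.Eq216Concrete

open Literature.MathematicalPhysics.QuantumFieldTheory.Balaban1983to89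
open B15DeterminingSets B14.Eq213DetSet
open Literature.MathematicalPhysics.QuantumFieldTheory.BalabanImbrieJaffe1984to88.BIJ85Eq453GaugeField
open scoped BigOperators

/-! ## §1  Locality of `M^j` (2.11) and of `Q_k^{s*}` (1.3), iterated -/

section Locality

variable {P : Params}

/-- The fine bonds on which the `j`-fold average `M^j(U)(c)` may depend, by the locality axiom of an averaging operation
(`Setup.Averaging.local_dep`: `Ū(c)` depends on `U` on the bonds issuing from the blocks `B(c₋)`, `B(c₊)`), iterated:
`feeds 0 c = {c}`, `feeds (j+1) c = ⋃ {feeds j b : B(b₋)'s block site is c₋ or c₊}`. [cite: Balaban1988Convergent, (2.11) p.256] -/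
def feeds : (j : ℕ) → PBond P j → Set (PBond P 0)
  | 0, c => {c}
  | j + 1, c => ⋃ (b : PBond P j) (_ : blockOf b.src = c.src ∨ blockOf b.src = c.tgt), feeds j b

/-- `feeds 0 c = {c}`. [cite: Balaban1988Convergent, (2.11) p.256] -/
@[simp] theorem feeds_zero (c : PBond P 0) : feeds 0 c = {c} := rfl

/-- Membership in `feeds (j+1) c`. [cite: Balaban1988Convergent, (2.11) p.256] -/
theorem mem_feeds_succ {j : ℕ} {c : PBond P (j + 1)} {b₀ : PBond P 0} :
    b₀ ∈ feeds (j + 1) c ↔ ∃ b : PBond P j, (blockOf b.src = c.src ∨ blockOf b.src = c.tgt) ∧ b₀ ∈ feeds j b := by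
  simp only [feeds, Set.mem_iUnion, exists_prop]

variable {G : Type*} [GaugeGroup G]

/-- **Locality of `M^j`, PROVED** (standing range `j ≤ m + K`): if `U = U′` on `feeds j c` then `M^j(U)(c) = M^j(U′)(c)` —
induction on `j` over the axiom `Averaging.local_dep`. [cite: Balaban1988Convergent, (2.11) p.256] -/
theorem iter_local (av : ∀ j, Averaging P j G) :
    ∀ (j : ℕ), j ≤ P.m + P.K → ∀ (U U' : GaugeField P 0 G) (c : PBond P j),
      (∀ b₀ ∈ feeds j c, U b₀ = U' b₀) → Averaging.iter av j U c = Averaging.iter av j U' c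
  | 0, _, U, U', c, h => h c (Set.mem_singleton c)
  | j + 1, hj, U, U', c, h => by
      show (av j).avg (Averaging.iter av j U) c = (av j).avg (Averaging.iter av j U') c
      exact (av j).local_dep hj _ _ c fun b hb =>
        iter_local av j (Nat.le_of_succ_le hj) U U' b fun b₀ hb₀ => h b₀ (mem_feeds_succ.2 ⟨b, hb, hb₀⟩)

/-- The fine bonds feeding the data `M_𝔅(U)` of (2.11) on a determining set `𝔅`: the `feeds` of the bonds of `𝔅` at every
scale. [cite: Balaban1988Convergent, (2.11) p.256] -/
def inputs (𝔅 : DetSet P) : Set (PBond P 0) :=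
  ⋃ (j : ℕ) (b : PBond P j) (_ : b ∈ bondsOf (𝔅 j)), feeds j b

/-- Membership in `inputs 𝔅`. [cite: Balaban1988Convergent, (2.11) p.256] -/
theorem mem_inputs {𝔅 : DetSet P} {b₀ : PBond P 0} :
    b₀ ∈ inputs 𝔅 ↔ ∃ (j : ℕ) (b : PBond P j), b ∈ bondsOf (𝔅 j) ∧ b₀ ∈ feeds j b := by
  simp only [inputs, Set.mem_iUnion, exists_prop]

/-- **(2.11) is local, PROVED**: for a determining set living in the standing range (`𝔅_j = ∅` for `j > m + K`), fine
configurations that agree on `inputs 𝔅` have (2.10)-agreeing data `M_𝔅(U) = M_𝔅(U′)` (`AgreeOn 𝔅`).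
[cite: Balaban1988Convergent, (2.10)–(2.11) p.256] -/
theorem agreeOn_avgFamily (av : ∀ j, Averaging P j G) (𝔅 : DetSet P) (h𝔅 : ∀ j, P.m + P.K < j → 𝔅 j = ∅)
    (U U' : GaugeField P 0 G) (h : ∀ b₀ ∈ inputs 𝔅, U b₀ = U' b₀) :
    AgreeOn 𝔅 (avgFamily av U) (avgFamily av U') := by
  intro j b hb
  by_cases hj : j ≤ P.m + P.K
  · exact iter_local av j hj U U' b fun b₀ hb₀ => h b₀ (mem_inputs.2 ⟨j, b, hb, hb₀⟩)
  · rw [h𝔅 j (not_le.1 hj)] at hb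
    simp [bondsOf] at hb

/-- One step up for bond sets: the coarse bonds `⟨B(b₋)'s site, μ(b)⟩` of the non-interior fine bonds `b ∈ S` — the bonds
of `T^{(j+1)}` whose values `Q^{s*}V` reads on `S` ((1.3): `(Q^{s*}V)(b) = V(c)` on the corridor `B(c)`, `= 1` inside blocks).
[cite: Balaban1988Convergent, (1.3) p.246] -/
def lift1 {j : ℕ} (S : Set (PBond P j)) : Set (PBond P (j + 1)) :=
  {c | ∃ b ∈ S, blockOf b.tgt ≠ blockOf b.src ∧ c = ⟨blockOf b.src, b.dir⟩}

/-- Membership in `lift1 S`. [cite: Balaban1988Convergent, (1.3) p.246] -/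
theorem mem_lift1 {j : ℕ} {S : Set (PBond P j)} {c : PBond P (j + 1)} :
    c ∈ lift1 S ↔ ∃ b ∈ S, blockOf b.tgt ≠ blockOf b.src ∧ c = ⟨blockOf b.src, b.dir⟩ := Iff.rfl

/-- `k` steps up: the bonds of `T^{(k)}` whose values the k-block pull-back `Q_k^{s*}V` reads on a set `S` of fine bonds.
[cite: Balaban1988Convergent, (1.3) p.246, (2.16) p.257] -/
def liftIter : (k : ℕ) → Set (PBond P 0) → Set (PBond P k)
  | 0, S => S
  | k + 1, S => lift1 (liftIter k S)

/-- `liftIter 0 S = S`. [cite: Balaban1988Convergent, (1.3) p.246] -/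
@[simp] theorem liftIter_zero (S : Set (PBond P 0)) : liftIter 0 S = S := rfl

/-- `liftIter (k+1) S = lift1 (liftIter k S)`. [cite: Balaban1988Convergent, (1.3) p.246] -/
theorem liftIter_succ (k : ℕ) (S : Set (PBond P 0)) : liftIter (k + 1) S = lift1 (liftIter k S) := rfl

/-- **(1.3) with k-blocks is local, PROVED**: `Q_k^{s*}V = Q_k^{s*}W` on `S` as soon as `V = W` on `liftIter k S` (induction
over the composite `Q^{s*}_{k+1}V = Q^{s*}_k(Q^{s*}V)`, one step = r11 gen 4's `qsstarG_local`).
[cite: Balaban1988Convergent, (1.3) p.246, (2.16) p.257] -/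
theorem qsstarGIter0_local : ∀ (k : ℕ) (S : Set (PBond P 0)) (V W : GaugeField P k G),
    (∀ c ∈ liftIter k S, V c = W c) → ∀ b ∈ S, qsstarGIter0 k V b = qsstarGIter0 k W b
  | 0, _, _, _, h => h
  | k + 1, S, V, W, h => fun b hb => by
      rw [qsstarGIter0_succ, qsstarGIter0_succ]
      refine qsstarGIter0_local k S (qsstarG V) (qsstarG W)
        (B14.Eq12LocalityQsstar.qsstarG_local (liftIter k S) V W fun c hc hne => h _ ?_) b hb
      rw [liftIter_succ, mem_lift1]
      exact ⟨c, hc, hne, rfl⟩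

end Locality

/-! ## §1b  (1.3) with k-blocks: the printed case formula for the base-0 composite `qsstarGIter0` (v1.1) -/

section QsstarIter

variable {P : Params} {G : Type*}

open B14.Eq22Determines

/-- The k-fold block map commutes with a unit shift up to the two printed cases: `B^k(x + e_μ)` is `B^k(x)` or `B^k(x) + e_μ`
(standing range; base-0 twin of p31's `BIJ85Eq224Proof.blockOfIter_shift` for r11's `blockIter`). [cite: Balaban1988Convergent, (1.3) p.246] -/
theorem blockIter_shift : ∀ (k : ℕ), k ≤ P.m + P.K → ∀ (x : Site P 0) (μ : Fin P.d),
    blockIter k (x.shift μ) = blockIter k x ∨ blockIter k (x.shift μ) = (blockIter k x).shift μ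
  | 0, _, _, _ => Or.inr rfl
  | k + 1, hk, x, μ => by
    simp only [blockIter_succ]
    rcases blockIter_shift k (Nat.le_of_succ_le hk) x μ with h | h
    · exact Or.inl (by rw [h])
    · rw [h]
      exact BalabanImbrieJaffe1984to88.BIJ85Eq219Proof.blockOf_tgt (by omega : k + 1 ≤ P.m + P.K) ⟨blockIter k x, μ⟩

/-- `y + e_μ ≠ y` on every torus of the series (`1 ≠ 0` in `ZMod (2L^{m+K−j})`). [folklore] -/
private theorem shift_ne_self' {j : ℕ} (y : Site P j) (μ : Fin P.d) : y.shift μ ≠ y := by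
  intro h
  have h1 := congrFun h μ
  simp only [Site.shift, Function.update_self] at h1
  exact one_ne_zero (add_eq_left.1 h1)

/-- **(2.16)'s clause «Q_k^{s*}V_k is defined as in (1.3), only 1-blocks are replaced by k-blocks», PROVED for the composite
of record**: `(Q_k^{s*}V)(b) = 1` if `b` lies strictly inside a k-block (`blockIter k b₊ = blockIter k b₋`), and `= V(c)` with
`c = ⟨blockIter k b₋, μ(b)⟩` the bond of `T^{(k)}` whose corridor contains `b` otherwise (standing range `k ≤ m + K`; the
base-0 twin of p31's `qsstarGIter_eq`). [cite: Balaban1988Convergent, (1.3) p.246, (2.16) p.257] -/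
theorem qsstarGIter0_eq [One G] : ∀ (k : ℕ), k ≤ P.m + P.K → ∀ (V : GaugeField P k G) (b : PBond P 0),
    qsstarGIter0 k V b = if blockIter k b.tgt = blockIter k b.src then 1 else V ⟨blockIter k b.src, b.dir⟩
  | 0, _, V, b => by
    have h : b.tgt ≠ b.src := shift_ne_self' b.src b.dir
    simp only [qsstarGIter0_zero, blockIter_zero, if_neg h]
  | k + 1, hk, V, b => by
    rw [qsstarGIter0_succ, qsstarGIter0_eq k (Nat.le_of_succ_le hk) (qsstarG V) b]
    simp only [blockIter_succ]
    by_cases h : blockIter k b.tgt = blockIter k b.src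
    · rw [if_pos h, if_pos (by rw [h])]
    · rw [if_neg h, qsstarG_apply]
      have ht : blockIter k b.tgt = (blockIter k b.src).shift b.dir :=
        (blockIter_shift k (Nat.le_of_succ_le hk) b.src b.dir).resolve_left h
      change (if blockOf ((blockIter k b.src).shift b.dir) = blockOf (blockIter k b.src) then (1 : G) else _) = _
      rw [← ht]

/-- (1.3) with k-blocks, first case: `(Q_k^{s*}V)(b) = 1` for `b` strictly inside a k-block. [cite: Balaban1988Convergent, (1.3) p.246] -/
theorem qsstarGIter0_of_interior [One G] {k : ℕ} (hk : k ≤ P.m + P.K) (V : GaugeField P k G) {b : PBond P 0}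
    (hb : blockIter k b.src = blockIter k b.tgt) : qsstarGIter0 k V b = 1 := by
  rw [qsstarGIter0_eq k hk, if_pos hb.symm]

/-- (1.3) with k-blocks, second case: `(Q_k^{s*}V)(b) = V⟨B^k(b₋), μ(b)⟩` for `b` not inside a k-block (a corridor bond).
[cite: Balaban1988Convergent, (1.3) p.246] -/
theorem qsstarGIter0_of_not_interior [One G] {k : ℕ} (hk : k ≤ P.m + P.K) (V : GaugeField P k G) {b : PBond P 0}
    (hb : blockIter k b.tgt ≠ blockIter k b.src) : qsstarGIter0 k V b = V ⟨blockIter k b.src, b.dir⟩ := by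
  rw [qsstarGIter0_eq k hk, if_neg hb]

end QsstarIter

/-! ## §2  (2.16): the localized background field `U_{k,□}(V_k)` WITH BODY -/

section UkBox

variable {P : Params} {G : Type*} [GaugeGroup G] {av : ∀ j, Averaging P j G}
variable (bg : DetBackground P G av) (M₁ : ℕ)

/-- **(2.16)** p. 257 [PDF 15], verbatim: *"for each cube □ of this partition we define the function U_{k,□}(V_k) by
U_{k,□}(V_k) = U(𝐁_k(□^{∼4}), M˙(Q_k^{s*}V_k)), (2.16) where Q_k^{s*}V_k is defined as in (1.3), only 1-blocks are
replaced by k-blocks"* — WITH BODY on the carriers of record: the (2.12) solution map `bg.U` at the (2.13) determining set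
`𝐁_k(□^{∼4}) = Bj M₁ □4 k` of the enlarged cube `□4 = □^{∼4} ⊂ T_η` and the (2.11) data `M˙(·) = avgFamily av` of the k-block
pull-back `Q_k^{s*}V_k = qsstarGIter0 k V_k`. [cite: Balaban1988Convergent, (2.16) p.257] -/
def ukBox (box4 : Set (Site P 0)) (k : ℕ) (Vk : GaugeField P k G) : GaugeField P 0 G :=
  bg.U (Bj M₁ box4 k) (avgFamily av (qsstarGIter0 k Vk))

/-- Unfolding of (2.16). [cite: Balaban1988Convergent, (2.16) p.257] -/
theorem ukBox_apply (box4 : Set (Site P 0)) (k : ℕ) (Vk : GaugeField P k G) :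
    ukBox bg M₁ box4 k Vk = bg.U (Bj M₁ box4 k) (avgFamily av (qsstarGIter0 k Vk)) := rfl

/-- p. 257: *"The notation in (2.16) is a slightly different, simplified version of the notation in (2.13)"* — PROVED as the
definitional identity `U_{k,□}(V_k) = U_{k,□^{∼4}}(M˙(Q_k^{s*}V_k))` with (2.13)'s `U_{j,Ω}(·) = minConf`.
[cite: Balaban1988Convergent, (2.13) pp.256–257, (2.16) p.257] -/
theorem ukBox_eq_minConf (box4 : Set (Site P 0)) (k : ℕ) (Vk : GaugeField P k G) :
    ukBox bg M₁ box4 k Vk = minConf M₁ bg box4 k (avgFamily av (qsstarGIter0 k Vk)) := rfl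

/-- (2.16) is r12's [Balaban1989LargeFieldI] (1.74) shape `U(𝔹, M˙(Q_k^{s*}V_k)) = bgKZ` with `𝔹 := 𝐁_k(□^{∼4})` and
`Q_k^{s*} := qsstarGIter0 k` (definitional). [cite: Balaban1988Convergent, (2.16) p.257] -/
theorem ukBox_eq_bgKZ (box4 : Set (Site P 0)) (k : ℕ) :
    ukBox bg M₁ box4 k = bgKZ bg (Bj M₁ box4 k) (qsstarGIter0 k) := rfl

/-- `U_{k,□}(V_k)` IS a minimal configuration of (2.12) for the determining set `𝐁_k(□^{∼4})` and the data
`M˙(Q_k^{s*}V_k)` (for data in the domain of the solution map). [cite: Balaban1988Convergent, (2.12) p.256, (2.16) p.257] -/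
theorem isMinimizer_ukBox {box4 : Set (Site P 0)} {k : ℕ} {Vk : GaugeField P k G}
    (hV : avgFamily av (qsstarGIter0 k Vk) ∈ bg.dom (Bj M₁ box4 k)) :
    IsMinimizer av bg.reg (Bj M₁ box4 k) (avgFamily av (qsstarGIter0 k Vk)) (ukBox bg M₁ box4 k Vk) :=
  bg.isMinimizer _ _ hV

/-- The case `k = 1` of (2.16) is **(1.2)** p. 246: `U_{1,□′}(V) = U(𝐁₁(□′^{∼4}), M˙(Q₁^{s*}V))` with `Q₁^{s*} = qsstarG`
of (1.3). [cite: Balaban1988Convergent, (1.2) p.246, (2.16) p.257] -/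
theorem ukBox_one (box4 : Set (Site P 0)) (V : GaugeField P 1 G) :
    ukBox bg M₁ box4 1 V = bg.U (Bj M₁ box4 1) (avgFamily av (qsstarG V)) := rfl

/-- **Dependence of (2.16) on `V_k`, exact conditional form.**  Let `S` be a set of fine bonds and `𝔅′` a determining set
in the standing range such that the [15] datum `U(𝐁_k(□^{∼4}), ·)` ON `S` depends on its data only through their values on
`𝔅′` (hypothesis `hloc` — the interior locality of the minimizer; print's case: `S` = the bonds of the support of
`𝐁_k(□^{∼4})`, `𝔅′ = 𝐁_k(□^{∼4})` restricted to `□^{∼4}`).  THEN `U_{k,□}(V_k) = U_{k,□}(W_k)` on `S` whenever `V_k = W_k` on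
`liftIter k (inputs 𝔅′)` — the averaging locality (`agreeOn_avgFamily`) and the (1.3)-locality (`qsstarGIter0_local`)
being PROVED. [cite: Balaban1988Convergent, (1.2) p.246, (2.16) p.257] -/
theorem ukBox_congr_on {box4 : Set (Site P 0)} {k : ℕ} (𝔅' : DetSet P) (h𝔅' : ∀ j, P.m + P.K < j → 𝔅' j = ∅)
    (S : Set (PBond P 0))
    (hloc : ∀ X X' : MSField P G, AgreeOn 𝔅' X X' →
      ∀ b₀ ∈ S, bg.U (Bj M₁ box4 k) X b₀ = bg.U (Bj M₁ box4 k) X' b₀)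
    {Vk Wk : GaugeField P k G} (h : ∀ c ∈ liftIter k (inputs 𝔅'), Vk c = Wk c) :
    ∀ b₀ ∈ S, ukBox bg M₁ box4 k Vk b₀ = ukBox bg M₁ box4 k Wk b₀ :=
  hloc _ _ (agreeOn_avgFamily av 𝔅' h𝔅' _ _ (qsstarGIter0_local k (inputs 𝔅') Vk Wk h))

/-- The whole-lattice form: if `U(𝐁_k(□^{∼4}), X)` depends on `X` only through `X` on `𝐁_k(□^{∼4})` ((2.10)-agreement),
then `U_{k,□}(V_k)` depends on `V_k` only through `V_k↾liftIter k (inputs 𝐁_k(□^{∼4}))` (`k ≤ m + K`).  See the module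
docstring's READING NOTE: through `Γ₀ = Ω₁ᶜ` of (2.2) this input family is large; print's *"restricted to □^{∼4}"* is the
support instance of `ukBox_congr_on`. [cite: Balaban1988Convergent, (1.2) p.246, (2.16) p.257] -/
theorem ukBox_congr {box4 : Set (Site P 0)} {k : ℕ} (hk : k ≤ P.m + P.K)
    (hloc : ∀ X X' : MSField P G, AgreeOn (Bj M₁ box4 k) X X' → bg.U (Bj M₁ box4 k) X = bg.U (Bj M₁ box4 k) X')
    {Vk Wk : GaugeField P k G} (h : ∀ c ∈ liftIter k (inputs (Bj M₁ box4 k)), Vk c = Wk c) :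
    ukBox bg M₁ box4 k Vk = ukBox bg M₁ box4 k Wk :=
  funext fun b₀ => ukBox_congr_on bg M₁ (Bj M₁ box4 k) (fun _ hj => Bj_of_gt (lt_of_le_of_lt hk hj)) Set.univ
    (fun X X' hX b _ => by rw [hloc X X' hX]) h b₀ (Set.mem_univ _)

/-! ## §3  (2.17): the small-field function `χ_k(Ω_k)` WITH BODY -/

variable {ι : Type*}

/-- **(2.17)** p. 257 [PDF 15], verbatim: *"χ_k(Ω_k) = Π_{□⊂Ω_k} χ({sup_{p⊂□^∼}|U_{k,□}(V_k, ∂p) − 1| < ε_kη²}), (2.17) where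
the cubes □ belong to the partition of the lattice T_η into cubes of the size LM₂R_k"* — WITH BODY over `Setup.chiSmall` and
(2.16): `X` the family of cubes `□ ⊂ Ω_k`, `plaqT □ = {p ⊂ □^∼}`, `enl4 □ = □^{∼4}`, threshold `ε_k·η²`, `η = L^{−k} = P.eta k`.
(This is a `Density P k G`, the `χ` slot of `Step.Repr218` in (2.18).) [cite: Balaban1988Convergent, (2.17) p.257] -/
def chi217 (X : Finset ι) (plaqT : ι → Set (Plaq P 0)) (enl4 : ι → Set (Site P 0)) (εk : ℝ) (k : ℕ)
    (Vk : GaugeField P k G) : ℝ :=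
  ∏ c ∈ X, chiSmall (plaqT c) (εk * P.eta k ^ 2) (ukBox bg M₁ (enl4 c) k Vk)

/-- Unfolding of (2.17). [cite: Balaban1988Convergent, (2.17) p.257] -/
theorem chi217_apply (X : Finset ι) (plaqT : ι → Set (Plaq P 0)) (enl4 : ι → Set (Site P 0)) (εk : ℝ) (k : ℕ)
    (Vk : GaugeField P k G) :
    chi217 bg M₁ X plaqT enl4 εk k Vk = ∏ c ∈ X, chiSmall (plaqT c) (εk * P.eta k ^ 2) (ukBox bg M₁ (enl4 c) k Vk) :=
  rfl

/-- `χ_k(Ω_k) = 1` exactly when every cube `□ ⊂ Ω_k` has all its plaquettes `p ⊂ □^∼` small for `U_{k,□}(V_k)`: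
`|U_{k,□}(V_k, ∂p) − 1| < ε_kη²` — the reading used on p. 266 (*"Thus χ_k(□) = 1, and …"*).
[cite: Balaban1988Convergent, (2.17) p.257] -/
theorem chi217_eq_one_iff (X : Finset ι) (plaqT : ι → Set (Plaq P 0)) (enl4 : ι → Set (Site P 0)) (εk : ℝ) (k : ℕ)
    (Vk : GaugeField P k G) :
    chi217 bg M₁ X plaqT enl4 εk k Vk = 1 ↔
      ∀ c ∈ X, PlaqSmallOn (plaqT c) (εk * P.eta k ^ 2) (ukBox bg M₁ (enl4 c) k Vk) := by
  classical
  unfold chi217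
  constructor
  · intro h c hc
    by_contra hn
    have h0 : ∏ c ∈ X, chiSmall (plaqT c) (εk * P.eta k ^ 2) (ukBox bg M₁ (enl4 c) k Vk) = 0 :=
      Finset.prod_eq_zero hc (by simp [chiSmall, hn])
    rw [h0] at h
    exact zero_ne_one h
  · intro h
    exact Finset.prod_eq_one fun c hc => by simp [chiSmall, h c hc]

/-- `χ_k` is multiplicative over disjoint cube families (`χ_k(Ω_k ∪ Ω′_k) = χ_k(Ω_k)χ_k(Ω′_k)`), as a product over cubes.
[cite: Balaban1988Convergent, (2.17) p.257] -/
theorem chi217_union [DecidableEq ι] {X Y : Finset ι} (hXY : Disjoint X Y) (plaqT : ι → Set (Plaq P 0))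
    (enl4 : ι → Set (Site P 0)) (εk : ℝ) (k : ℕ) (Vk : GaugeField P k G) :
    chi217 bg M₁ (X ∪ Y) plaqT enl4 εk k Vk = chi217 bg M₁ X plaqT enl4 εk k Vk * chi217 bg M₁ Y plaqT enl4 εk k Vk := by
  unfold chi217
  exact Finset.prod_union hXY

end UkBox

/-! ## §4  (1.2) and (1.4): the `Sect1Data` instance on the carriers of record -/

section SectOne

variable {P : Params} {G : Type} [GaugeGroup G] {av : ∀ j, Averaging P j G}
variable (bg : DetBackground P G av) (M₁ : ℕ)

open B14.Sect1Repr

/-- The Sect. 1 data with its analytic fields THE CARRIERS OF RECORD: determining sets `DetSet P` carrying multi-scale data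
`MSField P G`, the (2.12) solution map `U(𝐁, ·) := bg.U`, `𝐁₁(□′^{∼4}) := Bj M₁ (enl4 □′) 1` ((2.13) at `j = 1` for the
enlarged cube `enl4 □′ = □′^{∼4}`), `M˙ := avgFamily av` (2.11), `Q₁^{s*} := qsstarGIter0 1 = qsstarG` (1.3); the cube
geometry (`Cube0`, `Cube1`, plaquette sets, `inCompl`, `P11`) and the contour data `cd` of `D` are kept.
[cite: Balaban1988Convergent, (1.2) p.246] -/
def sect1Of (D : Sect1Data P G) (enl4 : D.Cube1 → Set (Site P 0)) : Sect1Data P G :=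
  { D with
    DetSet := B15DeterminingSets.DetSet P
    BData := MSField P G
    Umap := bg.U
    B1enl4 := fun c => Bj M₁ (enl4 c) 1
    Mdot := avgFamily av
    Qsstar := qsstarGIter0 1 }

/-- **(1.2) WITH BODY on the carriers of record**: for the instance, gen 2's `U1loc` IS (2.16) at `k = 1`:
`U_{1,□′}(V) = U(𝐁₁(□′^{∼4}), M˙(Q₁^{s*}V)) = ukBox bg M₁ (□′^{∼4}) 1 V` (definitional). [cite: Balaban1988Convergent, (1.2) p.246] -/
theorem u1loc_sect1Of (D : Sect1Data P G) (enl4 : D.Cube1 → Set (Site P 0)) (c : D.Cube1) (V : GaugeField P 1 G) :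
    U1loc (sect1Of bg M₁ D enl4) c V = ukBox bg M₁ (enl4 c) 1 V := rfl

/-- The instance's `Q₁^{s*}` is the printed (1.3) `qsstarG` (the hypothesis `hD` of gen 4's `u1locDependsOn_of_qsstarG`).
[cite: Balaban1988Convergent, (1.3) p.246] -/
theorem qsstar_sect1Of (D : Sect1Data P G) (enl4 : D.Cube1 → Set (Site P 0)) (V : GaugeField P 1 G) :
    (sect1Of bg M₁ D enl4).Qsstar V = qsstarG (j := 0) V := rfl

/-- **(1.4)** p. 246 for the instance: `Σ_{P₁⊂(P₀′^∼)ᶜ} χ₁(P₁ᶜ)(V) χ₁ᶜ(P₁)(V) = 1` with `χ₁` built on the CONCRETE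
`U_{1,□′}(V)` (gen 2's `eq14`, by name). [cite: Balaban1988Convergent, (1.4) p.246] -/
theorem eq14_sect1Of (D : Sect1Data P G) (enl4 : D.Cube1 → Set (Site P 0)) (ε₁ : ℝ) (P0 : Finset D.Cube0)
    (V : GaugeField P 1 G) :
    ∑ P1 ∈ ((sect1Of bg M₁ D enl4).inCompl P0).powerset,
      chi1 (sect1Of bg M₁ D enl4) ε₁ ((sect1Of bg M₁ D enl4).inCompl P0 \ P1) V *
        chi1c (sect1Of bg M₁ D enl4) ε₁ P1 V = 1 :=
  eq14 (sect1Of bg M₁ D enl4) ε₁ P0 V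

/-- The (1.4) function `χ₁(X)(V) = Π_{□′⊂X} χ({sup_{p⊂□′^∼}|U_{1,□′}(V, ∂p) − 1| < ε₁L⁻²})` of the instance IS (2.17) at
`k = 1` (`ε₁L⁻² = ε₁η²`, `η = L⁻¹`). [cite: Balaban1988Convergent, (1.4) p.246, (2.17) p.257] -/
theorem chi1_sect1Of (D : Sect1Data P G) (enl4 : D.Cube1 → Set (Site P 0)) (ε₁ : ℝ) (X : Finset D.Cube1)
    (V : GaugeField P 1 G) :
    chi1 (sect1Of bg M₁ D enl4) ε₁ X V = chi217 bg M₁ X D.plaqT1 enl4 ε₁ 1 V := by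
  unfold chi1 chi217
  refine Finset.prod_congr rfl fun c _ => ?_
  rw [show ε₁ * ((P.L : ℝ) ^ 2)⁻¹ = ε₁ * P.eta 1 ^ 2 by rw [Params.eta, pow_one, inv_pow]]
  rfl

/-- **The p. 246 sentence for the instance, exact conditional form**: *"The function in (1.2) depends on the field V
restricted to □′^{∼4}"* — IF the [15] datum `U(𝐁₁(□′^{∼4}), X)` depends on `X` only through `X` on `𝐁₁(□′^{∼4})`, THEN
`U_{1,□′}(V)` depends on `V` only through `V` on the `T^{(1)}`-bonds `liftIter 1 (inputs 𝐁₁(□′^{∼4}))` (gen 2's predicate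
`U1locDependsOn`; of gen 4's three localities (a) [15], (b) averaging, (c) (1.3), (b) and (c) are now PROVED on the
carriers, (a) is `hloc`).  Whole-lattice reading — see the READING NOTE of the module docstring for print's support reading.
[cite: Balaban1988Convergent, (1.2) p.246] -/
theorem u1locDependsOn_sect1Of (D : Sect1Data P G) (enl4 : D.Cube1 → Set (Site P 0)) (h1 : 1 ≤ P.m + P.K)
    (hloc : ∀ (c : D.Cube1) (X X' : MSField P G), AgreeOn (Bj M₁ (enl4 c) 1) X X' →
      bg.U (Bj M₁ (enl4 c) 1) X = bg.U (Bj M₁ (enl4 c) 1) X') :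
    U1locDependsOn (sect1Of bg M₁ D enl4) (fun c => liftIter 1 (inputs (Bj M₁ (enl4 c) 1))) :=
  fun c _ _ hVW => ukBox_congr bg M₁ h1 (hloc c) hVW

/-- The support form of the p. 246 sentence for the instance: with `S` the fine bonds where (1.4) reads `U_{1,□′}(V)` and
`𝔅′` the part of `𝐁₁(□′^{∼4})` the minimizer on `S` depends on (hypothesis `hloc`, [15]), `U_{1,□′}(V) = U_{1,□′}(W)` on `S`
whenever `V = W` on `lift1 (inputs 𝔅′)`. [cite: Balaban1988Convergent, (1.2) p.246] -/
theorem u1loc_congr_on (D : Sect1Data P G) (enl4 : D.Cube1 → Set (Site P 0)) (c : D.Cube1) (𝔅' : DetSet P)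
    (h𝔅' : ∀ j, P.m + P.K < j → 𝔅' j = ∅) (S : Set (PBond P 0))
    (hloc : ∀ X X' : MSField P G, AgreeOn 𝔅' X X' →
      ∀ b₀ ∈ S, bg.U (Bj M₁ (enl4 c) 1) X b₀ = bg.U (Bj M₁ (enl4 c) 1) X' b₀)
    {V W : GaugeField P 1 G} (h : ∀ c' ∈ lift1 (inputs 𝔅'), V c' = W c') :
    ∀ b₀ ∈ S, U1loc (sect1Of bg M₁ D enl4) c V b₀ = U1loc (sect1Of bg M₁ D enl4) c W b₀ :=
  ukBox_congr_on bg M₁ 𝔅' h𝔅' S hloc h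

end SectOne

/-! ## §5  (3.2)–(3.4): the `Sect3Data` instance on the carriers of record -/

section SectThree

variable {P : Params} {G : Type*} [GaugeGroup G] {av : ∀ j, Averaging P j G}
variable (bg : DetBackground P G av) (M₁ : ℕ) {k : ℕ}

open B14.Sect3Decomp

/-- The Sect. 3 data of step `k` with its localized background THE CARRIER OF RECORD: `UkLoc □′ := U_{k+1,□′}(·) = ukBox
bg M₁ (□′^{∼4}) (k+1)` ((2.16) at the next scale); the cube geometry (`Cube1`, `plaqT`, `bondsStar`, `inB`) of `D` is kept.
[cite: Balaban1988Convergent, (2.16) p.257, (3.2) p.265] -/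
def sect3Of (D : Sect3Data P G k) (enl4 : D.Cube1 → Set (Site P 0)) : Sect3Data P G k :=
  { D with UkLoc := fun c V => ukBox bg M₁ (enl4 c) (k + 1) V }

/-- The instance's `U_{k+1,□′}` is (2.16) at scale `k + 1` (definitional). [cite: Balaban1988Convergent, (2.16) p.257, (3.2) p.265] -/
theorem ukLoc_sect3Of (D : Sect3Data P G k) (enl4 : D.Cube1 → Set (Site P 0)) (c : D.Cube1)
    (V : GaugeField P (k + 1) G) : (sect3Of bg M₁ D enl4).UkLoc c V = ukBox bg M₁ (enl4 c) (k + 1) V := rfl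

/-- **(3.2)'s function IS (2.17) at the next scale**: `χ_{k+1}(X) = Π_{□′⊂X} χ({sup_{p⊂□′^∼}|U_{k+1,□′}(∂p) − 1| <
ε_{k+1}(L⁻¹η)²}) = chi217 … ε_{k+1} (k+1)` for the instance (definitional; `(L⁻¹η)² = (P.eta (k+1))²`).
[cite: Balaban1988Convergent, (3.2) p.265, (2.17) p.257] -/
theorem chiNext_sect3Of (D : Sect3Data P G k) (enl4 : D.Cube1 → Set (Site P 0)) (εk1 : ℝ) (X : Finset D.Cube1)
    (V : GaugeField P (k + 1) G) :
    chiNext (sect3Of bg M₁ D enl4) εk1 X V = chi217 bg M₁ X D.plaqT enl4 εk1 (k + 1) V := rfl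

/-- **(3.4) WITH BODY on the carriers**: `V^{(k)}_{□′} = M^k(U_{k+1,□′})` = the `k`-fold average of the concrete (2.16)
(gen 2's `Vbox`, definitional); equivalently the scale-`k` member of `M˙(U_{k+1,□′}) = avgFamily av (U_{k+1,□′})`.
[cite: Balaban1988Convergent, (3.4) p.265] -/
theorem vbox_sect3Of (D : Sect3Data P G k) (enl4 : D.Cube1 → Set (Site P 0)) (c : D.Cube1)
    (V : GaugeField P (k + 1) G) :
    Vbox (sect3Of bg M₁ D enl4) av c V = avgFamily av (ukBox bg M₁ (enl4 c) (k + 1) V) k := rfl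

/-- **(3.2)** p. 265 for the instance: `Σ_{P_{k+1}} χ_{k+1}(Pᶜ_{k+1}) χᶜ_{k+1}(P_{k+1}) = 1` with `χ_{k+1}` on the CONCRETE
`U_{k+1,□′}` (gen 2's `eq32`, by name). [cite: Balaban1988Convergent, (3.2) p.265] -/
theorem eq32_sect3Of (D : Sect3Data P G k) (enl4 : D.Cube1 → Set (Site P 0)) (εk1 : ℝ) (cubes : Finset D.Cube1)
    (V : GaugeField P (k + 1) G) :
    ∑ Pk ∈ cubes.powerset, chiNext (sect3Of bg M₁ D enl4) εk1 (cubes \ Pk) V *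
      chiNextc (sect3Of bg M₁ D enl4) εk1 Pk V = 1 :=
  eq32 (sect3Of bg M₁ D enl4) εk1 cubes V

/-- **(3.3)** p. 265 for the instance: `Σ_{Q_{k+1}} χ′_k(Qᶜ_{k+1}) χ′ᶜ_k(Q_{k+1}) = 1` with `V^{(k)}_{□′} = M^k(U_{k+1,□′})`
CONCRETE (gen 2's `eq33`, by name). [cite: Balaban1988Convergent, (3.3) p.265] -/
theorem eq33_sect3Of (D : Sect3Data P G k) (enl4 : D.Cube1 → Set (Site P 0)) (twoδ : ℝ) (Pk : Finset D.Cube1)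
    (Vk : GaugeField P k G) (V : GaugeField P (k + 1) G) :
    ∑ Qk ∈ ((sect3Of bg M₁ D enl4).inB Pk).powerset,
      chiPrime (sect3Of bg M₁ D enl4) av twoδ ((sect3Of bg M₁ D enl4).inB Pk \ Qk) Vk V *
        chiPrimec (sect3Of bg M₁ D enl4) av twoδ Qk Vk V = 1 :=
  eq33 (sect3Of bg M₁ D enl4) av twoδ Pk Vk V

/-- Dependence of (3.4) on `V_{k+1}` in the exact conditional form: under the [15] locality of the datum at
`𝐁_{k+1}(□′^{∼4})`, `V^{(k)}_{□′}(V) = V^{(k)}_{□′}(W)` whenever `V = W` on `liftIter (k+1) (inputs 𝐁_{k+1}(□′^{∼4}))`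
(`k + 1 ≤ m + K`). [cite: Balaban1988Convergent, (3.4) p.265] -/
theorem vbox_congr (D : Sect3Data P G k) (enl4 : D.Cube1 → Set (Site P 0)) (c : D.Cube1) (hk : k + 1 ≤ P.m + P.K)
    (hloc : ∀ X X' : MSField P G, AgreeOn (Bj M₁ (enl4 c) (k + 1)) X X' →
      bg.U (Bj M₁ (enl4 c) (k + 1)) X = bg.U (Bj M₁ (enl4 c) (k + 1)) X')
    {V W : GaugeField P (k + 1) G} (h : ∀ c' ∈ liftIter (k + 1) (inputs (Bj M₁ (enl4 c) (k + 1))), V c' = W c') :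
    Vbox (sect3Of bg M₁ D enl4) av c V = Vbox (sect3Of bg M₁ D enl4) av c W := by
  rw [vbox_sect3Of, vbox_sect3Of, ukBox_congr bg M₁ hk hloc h]

end SectThree

end Literature.MathematicalPhysics.QuantumFieldTheory.Balaban1983to89.B14.Eq216Concrete
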